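import Summits.BirchSwinnertonDyer.BirchSwinnertonDyer.Theorems.UniversalToricDescentKernelRationalRoadOddTMuOfR2
import Summits.BirchSwinnertonDyer.BirchSwinnertonDyer.Theorems.UniversalToricDescentTwinMuZeroAtThreeTOfBuckets
import HarnessLib

/-!
# Route `UniversalToricDescent` — hKr″: the RATIONAL road's kernel in RK-7 v2's B-SHAPE
# (`BCSMuZeroInput → TwinMuZeroAtThreeMultOdd →` in place of `TwinMuZeroAtThree →`), restate-robust in `TwinAlgMuZeroAtThree`

Width prover `bsd-wall-utd-p1-w2` g7 under LEAD `bsd-wall-utd-p1` g20 (`--supports stmt-BirchSwinnertonDyer-20400`). Pen pss3x g9's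
RK-7 v2 (`Cruxes/ToricTransportModThree/PEN-MEMO-RK7-v2.md` bb311f5e9220f088, Option B; needs director GO): four NEW items, among them
hKr″ `ToricKernelAtThreeApZeroOddRationalTwinMuBOfPrint` := the CLOSED kernel_rat⁺ 24256's text with `TwinMuZeroAtThree →` replaced by
`BCSMuZeroInput → TwinMuZeroAtThreeMultOdd →` (`TwinAlgMuZeroAtThree` by NAME, hence R2-robust). THIS FILE types hKr″ BY TEXT before the
touch: `kernelRat_of_bcs422_of_multOdd` — `BCSMuZeroInput` by name (item 20790), the B residue's text VERBATIM (1989 characters of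
`RK7_sketch_pen_g8.lean` 51f2aaf68cacd05b), `TwinAlgMuZeroAtThree` by name, all other antecedents by name. Proof: the T-text from w2 g7's
glue `…TwinMuZeroT.twinMuZeroAtThreeT_of_bcs422_of_multOdd h422 hB` (p722155), then the T-shaped kernel of `…KernelRationalRoadOddTMuOfR2`
(p723575, `kernelRat_of_liveAlgMu_of_tText`: `TwinAlgMuZeroAtThree` BY NAME, restate-robust by `first` over R2 / R1 / the pre-rev-87 live
text — the device of the LEAD's 24256 closer p722699); the statement names `TwinAlgMuZeroAtThree` only by name, so it is byte-stable
across restates (R2 is the text of record since UTD rev 87, 13:54:54Z). Once the pen files hKr″, its closer is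
`by intro hF hA hR h422 hB hTμ h3 hsupply hres hW hS hL hZ; exact kernelRat_of_bcs422_of_multOdd hF hA hR h422 hB hTμ h3 hsupply hres hW hS hL hZ`.

THEOREMS ONLY; no definition, no named fact, no `sorry`. HONEST FRAMING: an implication between route items / one candidate text and
displayed hypotheses (h422 = BCS 2025 Prop. 4.2.2 is print; B = `3 ∥ N′` très-ramifié odd-`d_K` analytic `μ = 0` is research; A 27120,
the rational wall 24207 and `TwinAlgMuZeroAtThree` 24254 are open); BSD is proved for no curve by this file; RK-7 v2 needs director GO.
References: [BurungaleCastellaSkinner2025] Prop. 4.2.2; [GreenbergVatsal2000] Thm. (1.4), Prop. (2.8); [JetchevSkinnerWan2017] §7.4.1.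
-/

noncomputable section

open scoped Classical

set_option linter.dupNamespace false
set_option autoImplicit false

namespace Summit.BirchSwinnertonDyer.BirchSwinnertonDyer.Theorems.UniversalToricDescentKernelRationalRoadOddT

open WeierstrassCurve NumberField IsDedekindDomain Field
  Literature.NumberTheory.EllipticCurves
  Literature.NumberTheory.EllipticCurves.ModularForms
  Literature.NumberTheory.EllipticCurves.Rank1Residual
  Literature.NumberTheory.EllipticCurves.KrizLi2019
  Literature.NumberTheory.EllipticCurves.LiuZhangZhang2018
  Summit.BirchSwinnertonDyer.Rank1Residual
  Summit.BirchSwinnertonDyer.Rank1Residual.Additive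
  Summit.BirchSwinnertonDyer.Rank1Residual.X11b
  Summit.BirchSwinnertonDyer.Rank1Residual.X11b.AcSelmer
  Summit.BirchSwinnertonDyer.Rank1Residual.X11b.Halves
  Summit.BirchSwinnertonDyer.BirchSwinnertonDyer.Theses.UniversalToricDescent
  Summit.BirchSwinnertonDyer.BirchSwinnertonDyer.Theorems
  Summit.BirchSwinnertonDyer.BirchSwinnertonDyer.Theorems.UniversalToricDescentTwinChoice
  Summit.BirchSwinnertonDyer.BirchSwinnertonDyer.Theorems.UniversalToricDescentWaldspurgerFlat
  Summit.BirchSwinnertonDyer.BirchSwinnertonDyer.Theorems.UniversalToricDescentKernelOdd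
  Summit.BirchSwinnertonDyer.BirchSwinnertonDyer.Theorems.UniversalToricDescentKernelOfPrint
  Summit.BirchSwinnertonDyer.BirchSwinnertonDyer.Theorems.UniversalToricDescentKernelFlatOfPrint
  Summit.BirchSwinnertonDyer.BirchSwinnertonDyer.Theorems.UniversalToricDescentActDFlatGlue
  Summit.BirchSwinnertonDyer.BirchSwinnertonDyer.Theorems.UniversalToricDescentNormProfile
  Summit.BirchSwinnertonDyer.BirchSwinnertonDyer.Theorems.UniversalToricDescentDefectTransport
  Summit.BirchSwinnertonDyer.BirchSwinnertonDyer.Theorems.UniversalToricDescentDefectPTSqueeze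
  Summit.BirchSwinnertonDyer.BirchSwinnertonDyer.Theorems.UniversalToricDescentKernelDefectPTOfPrint
  Summit.BirchSwinnertonDyer.BirchSwinnertonDyer.Theorems.UniversalToricDescentKernelDefectPTTROfPrint
  Summit.BirchSwinnertonDyer.BirchSwinnertonDyer.Theorems.UniversalToricDescentKernelDegreeOnlyTwin
  Summit.BirchSwinnertonDyer.BirchSwinnertonDyer.Theorems.UniversalToricDescentKernelDegreeOnlyTwinOfPrint
  Summit.BirchSwinnertonDyer.BirchSwinnertonDyer.Cruxes.ToricTransportModThree
  Summit.BirchSwinnertonDyer.BirchSwinnertonDyer.Theorems.UniversalToricDescentKernelRationalRoad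
  Summit.BirchSwinnertonDyer.BirchSwinnertonDyer.Theorems.UniversalToricDescentKernelRationalRoadOdd

/-- **hKr″ = kernel_rat⁺ in RK-7 v2's B-SHAPE**: the text of item 24256 with `TwinMuZeroAtThree →` replaced by
`BCSMuZeroInput → TwinMuZeroAtThreeMultOdd →` (leaf 20790 BY NAME + the B residue's text VERBATIM), `TwinAlgMuZeroAtThree` and every
other antecedent BY NAME. Proof = glue p722155 (h422 + B ⇒ T-text) + the T-shaped kernel `kernelRat_of_liveAlgMu_of_tText` (p723575 + hotfix), which is
restate-robust in `TwinAlgMuZeroAtThree` (`first` over R2 / R1 / pre-rev-87 live). CONDITIONAL on every displayed antecedent; BSD is proved for no curve by this.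
[cite: BurungaleCastellaSkinner2025, Prop. 4.2.2 (§4.2, pp. 8–9 of arXiv:2405.00270v2)] [cite: GreenbergVatsal2000, Thm. (1.4), Prop. (2.8)]
[cite: JetchevSkinnerWan2017, §7.4.1] -/
theorem kernelRat_of_bcs422_of_multOdd (hF : ToricPublishedInputs) (hA : SigmaCongruenceAtThree)
    (hR : RationalSplitIMCInclusionAtThree) (h422 : BCSMuZeroInput)
    (hB : ∀ (W : WeierstrassCurve ℚ) [W.IsElliptic] [W.IsGloballyMinimal] (W' : WeierstrassCurve ℚ) [W'.IsElliptic] [W'.IsGloballyMinimal] (N N' : ℕ) [NeZero N] [NeZero N'] (K : Type) [Field K] [NumberField K] (Dt : Literature.NumberTheory.EllipticCurves.ModularForms.ModularParametrizationData W N) (Dt' : Literature.NumberTheory.EllipticCurves.ModularForms.ModularParametrizationData W' N'), Summit.BirchSwinnertonDyer.Rank1Residual.Additive.ClassO6 W 3 → W.HasSurjectiveModNGaloisRep 3 → W.analyticRank = 1 → W.conductorNorm ℤ = N → Summit.BirchSwinnertonDyer.Rank1Residual.O6.ModPCongruent W' W 3 → ¬ Literature.NumberTheory.EllipticCurves.Rank1Residual.Addv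 W' 3 → W'.conductorNorm ℤ = N' → Literature.NumberTheory.EllipticCurves.IsImaginaryQuadratic K → Literature.NumberTheory.EllipticCurves.SatisfiesHeegnerHypothesis N K → Literature.NumberTheory.EllipticCurves.SatisfiesHeegnerHypothesis N' K → Odd (NumberField.discr K) → (Literature.NumberTheory.EllipticCurves.Rank1Residual.Mult W' 3 ∧ ¬ 3 ∣ padicValInt 3 W'.minimalDiscriminantInt) → ∀ (κ : Literature.NumberTheory.EllipticCurves.ZpExtension K 3), κ.IsAnticyclotomic → ∀ (γ : Field.absoluteGaloisGroup K) [Fact (κ.IsTopGenerator γ)] (𝔭 : IsDedekindDomain.HeightOneSpectrum (NumberField.RingOfIntegers K)), ((3 : ℕ) : NumberField.RingOfIntegers K) ∈ 𝔭.asIdeal → 𝔭.asIdeal.ramificationIdx (NumberField.RingOfIntegers ℚ) = 1 → 𝔭.asIdeal.inertiaDeg (NumberField.RingOfIntegers ℚ) = 1 → ∀ (𝔭' : IsDedekindDomain.HeightOneSpectrum (NumberField.RingOfIntegers K)), ((3 : ℕ) : NumberField.RingOfIntegers K) ∈ 𝔭'.asIdeal → 𝔭' ≠ 𝔭 → ∀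 (ι' : PadicAlgCl 3 ≃+* ℂ), Summit.BirchSwinnertonDyer.BirchSwinnertonDyer.Theorems.SchneiderFree.BranchInducesPrime 3 ι' 𝔭 → ∀ (ΩK : ℂ) (Ωp : ℂ_[3]) (L' : Literature.NumberTheory.EllipticCurves.UnrSeries 3), ΩK ≠ 0 → Ωp ≠ 0 → Literature.NumberTheory.EllipticCurves.IsBDPLFunction ι' 𝔭 κ γ Dt'.f ΩK Ωp L' → ∃ i : ℕ, ‖((PowerSeries.coeff i L' : Literature.NumberTheory.EllipticCurves.unrIntegers 3) : ℂ_[3])‖ = 1)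
    (hTμ : TwinAlgMuZeroAtThree)
    (h3 : TwinDegreeFrameAtThreeMultTresT ∧ TwinDegreeFrameAtThreeGoodSSApZeroT) (hsupply : GoodSSApZeroTwinSupplyAtThree)
    (hres : PeuRamifieMultTwinResupplyAtThree) (hW : WildSplitPrintedInputsAtThree) (hS : WildSplitFrameAtThreeOddOfPrint)
    (hL : ToricPrintedLeavesAtThree) (hZ : WildRankZeroTwistAtThree) :
    ∀ (W : WeierstrassCurve ℚ) [W.IsElliptic] [W.IsGloballyMinimal], Additive.ClassO6 W 3 →
      W.analyticRank = 1 → W.HasSurjectiveModNGaloisRep 3 →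
      (∃ (W' : WeierstrassCurve ℚ) (_ : W'.IsElliptic) (_ : W'.IsGloballyMinimal),
        O6.ModPCongruent W' W 3 ∧ ¬ Addv W' 3 ∧ W'.HasSurjectiveModNGaloisRep 3) → BSDp W 3 :=
  kernelRat_of_liveAlgMu_of_tText hF hA hR (UniversalToricDescentTwinMuZeroT.twinMuZeroAtThreeT_of_bcs422_of_multOdd h422 hB) hTμ
    h3 hsupply hres hW hS hL hZ

end Summit.BirchSwinnertonDyer.BirchSwinnertonDyer.Theorems.UniversalToricDescentKernelRationalRoadOddT

end
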